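import Literature.Analysis.SingularIntegrals.HardyLittlewoodMaximal
import Literature.Analysis.FunctionSpaces.PoincareWirtingerConvex
import Mathlib.Analysis.Calculus.MeanValue
import HarnessLib

/-!
# The two-point maximal inequality for `C¹` functions (Hedberg–Hajłasz)

Analysis/SingularIntegrals support file (everything proved). For a `C¹` map `g : E → F` on a
finite-dimensional real normed space `E` with an additive Haar measure `μ`, and a measurable
size `φ ≥ ‖Dg‖ₑ`, we prove the pointwise **two-point inequality through the Hardy–Littlewood
maximal function**

  `‖g a - g b‖ ≤ Cₙ ‖a - b‖ (Mφ_a(a) + Mφ_b(b))`,  `Cₙ = 3 (3/2)ⁿ`, `n = dim E`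

(`Literature.Analysis.SingularIntegrals.enorm_sub_le_mul_maximalFunction_add`), where
`Mφ_a = M(φ 1_{B(a, 3‖a-b‖)})` only sees `φ` near `a` (so that periodic sizes can be localised
downstream). This is the classical Hedberg potential estimate behind the Lusin–Lipschitz /
Hajłasz characterisation of Sobolev functions (Hajłasz 1996, Thm. 1 and (4): for
`u ∈ W^{1,p}`, `|u(x) - u(y)| ≤ |x-y| (g(x) + g(y))` with `g = C M|∇u| ∈ L^p`; E. M. Stein 1970,
Ch. I; used in fluid mechanics through Crippa–De Lellis 2008), and it serves the discharge of
the named facts `Literature.Analysis.FluidPDE.Seis2022_rmk1_L2` / `Seis2022_thm2_L2`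
(`FluidPDE/SeisDissipationRateBound`), where it replaces the transport-plan estimate of
Seis 2022, Lemma 3.

Printed-style proof, as formalised:
* `setLIntegral_ball_comp_homothety` — the substitution `w = c + t(z - c)` on a ball:
  `∫_{B(a,R)} φ(c + t(z-c)) dz = t⁻ⁿ ∫_{B(c + t(a-c), tR)} φ` (indicator bookkeeping and the tree's
  homothety lemma `Literature.Analysis.FunctionSpaces.lintegral_comp_smul`);
* `setLIntegral_ball_comp_homothety_le` — hence, with `D = dist a c` and `0 < t ≤ 1`,
  `∫_{B(a,R)} φ(c + t(z-c)) dz ≤ ((R+D)/R)ⁿ μ(B(a,R)) · M(φ 1_{B(c,R+D)})(c)`;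
* `enorm_sub_le_lintegral_segment` — `‖g z - g c‖ ≤ L ∫₀¹ φ(c + τ(z-c)) dτ` for `‖z - c‖ ≤ L`;
* `enorm_setAverage_sub_le` — averaging and Tonelli:
  `‖⨍_{B(a,R)} g - g(c)‖ ≤ (R+D) ((R+D)/R)ⁿ M(φ 1_{B(c,R+D)})(c)`;
* the two-point inequality: compare `g a` and `g b` with `⨍_{B(a, 2r)} g`, `r = ‖a - b‖`.

## Mathlib / tree search

Mathlib (this pin): no maximal function, no Hajłasz/Lusin–Lipschitz inequality (searched
`maximal`, `Hajlasz`, `Lusin`). Tree: `SingularIntegrals/HardyLittlewoodMaximal`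
(`maximalFunction`, `setLIntegral_ball_le_maximalFunction_mul`, strong type `(p,p)`),
`FunctionSpaces/PoincareWirtingerConvex` (`lintegral_comp_smul`, segment estimates in `L²` form).

## References

* P. Hajłasz, *Sobolev spaces on an arbitrary metric space*, Potential Anal. 5 (1996), 403–415,
  Thm. 1 and (4).
* E. M. Stein, *Singular integrals and differentiability properties of functions* (1970),
  Ch. I §1. [`Stein1971`]
* G. Crippa, C. De Lellis, J. reine angew. Math. 616 (2008), 15–46, Lemma A.3 (the form used in
  transport theory).
-/

noncomputable section

open MeasureTheory MeasureTheory.Measure Metric Set Filter Function Module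
open scoped ENNReal NNReal Topology

namespace Literature.Analysis.SingularIntegrals

variable {E : Type*} [NormedAddCommGroup E] [NormedSpace ℝ E] [FiniteDimensional ℝ E]
  [MeasurableSpace E] [BorelSpace E] (μ : Measure E) [μ.IsAddHaarMeasure]
variable {F : Type*} [NormedAddCommGroup F] [NormedSpace ℝ F]

/-! ## The homothety substitution on balls -/

omit [FiniteDimensional ℝ E] [MeasurableSpace E] [BorelSpace E] in
/-- Membership bookkeeping for the substitution `w = c + t(z - c)`:
`z ∈ B(a,R) ↔ c + t(z-c) ∈ B(c + t(a-c), tR)` for `t > 0`. [folklore] -/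
theorem mem_ball_iff_homothety_mem_ball (a c z : E) {R t : ℝ} (ht : 0 < t) :
    z ∈ ball a R ↔ c + t • (z - c) ∈ ball (c + t • (a - c)) (t * R) := by
  rw [mem_ball, mem_ball, dist_eq_norm, dist_eq_norm]
  have e : c + t • (z - c) - (c + t • (a - c)) = t • (z - a) := by module
  rw [e, norm_smul, Real.norm_eq_abs, abs_of_pos ht]
  exact ⟨fun h => mul_lt_mul_of_pos_left h ht, fun h => lt_of_mul_lt_mul_left h ht.le⟩

/-- **The homothety substitution on a ball**: for a size `φ`, `t > 0`,
`∫_{B(a,R)} φ(c + t(z - c)) dz = t⁻ⁿ ∫_{B(c + t(a-c), tR)} φ`. [folklore] -/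
theorem setLIntegral_ball_comp_homothety (φ : E → ℝ≥0∞) (a c : E) (R : ℝ) {t : ℝ} (ht : 0 < t) :
    ∫⁻ z in ball a R, φ (c + t • (z - c)) ∂μ =
      ENNReal.ofReal ((t ^ finrank ℝ E)⁻¹) * ∫⁻ w in ball (c + t • (a - c)) (t * R), φ w ∂μ := by
  set B' : Set E := ball (c + t • (a - c)) (t * R) with hB'
  set ψ : E → ℝ≥0∞ := B'.indicator φ with hψ
  have hpt : ∀ z, (ball a R).indicator (fun z => φ (c + t • (z - c))) z = ψ (c + t • (z - c)) := by
    intro z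
    by_cases hz : z ∈ ball a R
    · have hw : c + t • (z - c) ∈ B' := (mem_ball_iff_homothety_mem_ball a c z ht).1 hz
      rw [indicator_of_mem hz, hψ, indicator_of_mem hw]
    · have hw : c + t • (z - c) ∉ B' := fun h => hz ((mem_ball_iff_homothety_mem_ball a c z ht).2 h)
      rw [indicator_of_notMem hz, hψ, indicator_of_notMem hw]
  have hshift : ∀ z : E, c + t • (z - c) = t • z + (c - t • c) := fun z => by module
  calc ∫⁻ z in ball a R, φ (c + t • (z - c)) ∂μ
      = ∫⁻ z, (ball a R).indicator (fun z => φ (c + t • (z - c))) z ∂μ := (lintegral_indicator measurableSet_ball _).symm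
    _ = ∫⁻ z, ψ (c + t • (z - c)) ∂μ := lintegral_congr hpt
    _ = ∫⁻ z, (fun u => ψ (u + (c - t • c))) (t • z) ∂μ := by simp_rw [hshift]
    _ = ENNReal.ofReal |(t ^ finrank ℝ E)⁻¹| * ∫⁻ u, ψ (u + (c - t • c)) ∂μ :=
        Literature.Analysis.FunctionSpaces.lintegral_comp_smul μ (fun u => ψ (u + (c - t • c))) ht.ne'
    _ = ENNReal.ofReal ((t ^ finrank ℝ E)⁻¹) * ∫⁻ u, ψ u ∂μ := by
        rw [lintegral_add_right_eq_self, abs_of_pos (inv_pos.2 (pow_pos ht _))]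
    _ = _ := by rw [hψ, lintegral_indicator measurableSet_ball]

/-- **The averaged size along scaled segments is controlled by the maximal function.** For a
size `φ`, points `a, c`, a radius `R > 0`, `D = dist a c` and `0 < t ≤ 1`:
`∫_{B(a,R)} φ(c + t(z-c)) dz ≤ ((R+D)/R)ⁿ μ(B(a,R)) · M(φ 1_{B(c,R+D)})(c)`
(the image ball `B(c + t(a-c), tR)` lies in `B(c, t(R+D))`, whose measure is `tⁿ (R+D)ⁿ μ(B₁)`,
while `μ(B(a,R)) = Rⁿ μ(B₁)`). [folklore] -/
theorem setLIntegral_ball_comp_homothety_le (φ : E → ℝ≥0∞) (a c : E) {R : ℝ} (hR : 0 < R)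
    {t : ℝ} (ht : 0 < t) (ht1 : t ≤ 1) :
    ∫⁻ z in ball a R, φ (c + t • (z - c)) ∂μ ≤
      ENNReal.ofReal (((R + dist a c) / R) ^ finrank ℝ E) * μ (ball a R) *
        maximalFunction μ ((ball c (R + dist a c)).indicator φ) c := by
  set n := finrank ℝ E with hn
  set D := dist a c with hD
  have hD0 : 0 ≤ D := dist_nonneg
  have hRD : 0 < R + D := by linarith
  have htRD : 0 < t * (R + D) := mul_pos ht hRD
  set K : Set E := ball c (R + D) with hK
  -- the image ball lies in `B(c, t(R+D)) ⊆ K`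
  have hsub : ball (c + t • (a - c)) (t * R) ⊆ ball c (t * (R + D)) := by
    intro w hw
    rw [mem_ball] at hw ⊢
    calc dist w c ≤ dist w (c + t • (a - c)) + dist (c + t • (a - c)) c := dist_triangle _ _ _
      _ < t * R + t * D := by
          refine add_lt_add_of_lt_of_le hw ?_
          rw [dist_eq_norm, add_sub_cancel_left, norm_smul, Real.norm_eq_abs, abs_of_pos ht, hD,
            dist_eq_norm]
      _ = t * (R + D) := by ring
  have hsubK : ball c (t * (R + D)) ⊆ K := ball_subset_ball (by nlinarith)
  -- on `B(c, t(R+D))` the size agrees with its localisation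
  have hloc : ∫⁻ w in ball c (t * (R + D)), φ w ∂μ = ∫⁻ w in ball c (t * (R + D)), K.indicator φ w ∂μ :=
    setLIntegral_congr_fun measurableSet_ball fun w hw => by rw [indicator_of_mem (hsubK hw)]
  -- volumes
  have hvol : ENNReal.ofReal ((t ^ n)⁻¹) * μ (ball c (t * (R + D))) =
      ENNReal.ofReal (((R + D) / R) ^ n) * μ (ball a R) := by
    rw [addHaar_ball_of_pos μ c htRD, addHaar_ball_of_pos μ a hR, ← mul_assoc, ← mul_assoc,
      ← ENNReal.ofReal_mul (inv_nonneg.2 (pow_nonneg ht.le _)),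
      ← ENNReal.ofReal_mul (pow_nonneg (div_nonneg hRD.le hR.le) _)]
    congr 2
    rw [mul_pow, div_pow, ← hn]
    field_simp
  calc ∫⁻ z in ball a R, φ (c + t • (z - c)) ∂μ
      = ENNReal.ofReal ((t ^ n)⁻¹) * ∫⁻ w in ball (c + t • (a - c)) (t * R), φ w ∂μ :=
        setLIntegral_ball_comp_homothety μ φ a c R ht
    _ ≤ ENNReal.ofReal ((t ^ n)⁻¹) * ∫⁻ w in ball c (t * (R + D)), K.indicator φ w ∂μ := by
        rw [← hloc]
        exact mul_le_mul' le_rfl (lintegral_mono_set hsub)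
    _ ≤ ENNReal.ofReal ((t ^ n)⁻¹) * (maximalFunction μ (K.indicator φ) c * μ (ball c (t * (R + D)))) :=
        mul_le_mul' le_rfl (setLIntegral_ball_le_maximalFunction_mul μ _ c htRD)
    _ = ENNReal.ofReal ((t ^ n)⁻¹) * μ (ball c (t * (R + D))) * maximalFunction μ (K.indicator φ) c := by ring
    _ = _ := by rw [hvol]

/-! ## The segment estimate -/

omit [MeasurableSpace E] [BorelSpace E] [FiniteDimensional ℝ E] in
/-- **Fundamental theorem of calculus along a segment**: for `g ∈ C¹`, a size `φ ≥ ‖Dg‖ₑ` and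
`‖z - c‖ ≤ L`, `‖g z - g c‖ₑ ≤ L ∫_{[0,1]} φ(c + τ(z - c)) dτ`. [folklore] -/
theorem enorm_sub_le_lintegral_segment [CompleteSpace F] {g : E → F} (hg : ContDiff ℝ 1 g)
    {φ : E → ℝ≥0∞} (hφ : ∀ w, ‖fderiv ℝ g w‖ₑ ≤ φ w) {L : ℝ} {z c : E} (hzc : ‖z - c‖ ≤ L) :
    ‖g z - g c‖ₑ ≤ ENNReal.ofReal L * ∫⁻ τ in Icc (0 : ℝ) 1, φ (c + τ • (z - c)) := by
  have hL : 0 ≤ L := (norm_nonneg _).trans hzc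
  set γ : ℝ → E := fun τ => c + τ • (z - c) with hγ
  set w : ℝ → F := fun τ => fderiv ℝ g (γ τ) (z - c) with hw
  have hγd : ∀ τ, HasDerivAt γ (z - c) τ := fun τ => by
    simpa [hγ] using ((hasDerivAt_id τ).smul_const (z - c)).const_add c
  have hderiv : ∀ τ, HasDerivAt (g ∘ γ) (w τ) τ := fun τ =>
    ((hg.differentiable one_ne_zero) (γ τ)).hasFDerivAt.comp_hasDerivAt τ (hγd τ)
  have hwc : Continuous w := by
    have h1 : Continuous fun τ => fderiv ℝ g (γ τ) :=
      (hg.continuous_fderiv one_ne_zero).comp (by fun_prop)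
    exact h1.clm_apply continuous_const
  have hftc : ∫ τ in (0 : ℝ)..1, w τ = g z - g c := by
    have h := intervalIntegral.integral_eq_sub_of_hasDerivAt (fun τ _ => hderiv τ)
      (hwc.intervalIntegrable 0 1)
    simpa [hγ] using h
  have hwb : ∀ τ, ‖w τ‖ₑ ≤ φ (γ τ) * ENNReal.ofReal L := fun τ => by
    refine le_trans ?_ (mul_le_mul' (hφ (γ τ)) le_rfl)
    rw [← ofReal_norm, ← ofReal_norm, ← ENNReal.ofReal_mul (norm_nonneg _)]
    exact ENNReal.ofReal_le_ofReal (((fderiv ℝ g (γ τ)).le_opNorm _).trans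
      (mul_le_mul_of_nonneg_left hzc (norm_nonneg _)))
  calc ‖g z - g c‖ₑ = ‖∫ τ in (0 : ℝ)..1, w τ‖ₑ := by rw [hftc]
    _ ≤ ∫⁻ τ in Icc (0 : ℝ) 1, ‖w τ‖ₑ := by
        rw [intervalIntegral.integral_of_le zero_le_one]
        exact (enorm_integral_le_lintegral_enorm _).trans (lintegral_mono_set Ioc_subset_Icc_self)
    _ ≤ ∫⁻ τ in Icc (0 : ℝ) 1, φ (γ τ) * ENNReal.ofReal L := lintegral_mono fun τ => hwb τ
    _ = ENNReal.ofReal L * ∫⁻ τ in Icc (0 : ℝ) 1, φ (c + τ • (z - c)) := by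
        rw [lintegral_mul_const' _ _ ENNReal.ofReal_ne_top, mul_comm]

/-! ## Averages over balls against the maximal function -/

/-- **Potential estimate for ball averages.** For `g ∈ C¹`, a measurable size `φ ≥ ‖Dg‖ₑ`,
points `a, c`, a radius `R > 0` and `D = dist a c`:
`‖(μ B)⁻¹ ∫_B g - g c‖ₑ ≤ (R+D) ((R+D)/R)ⁿ · M(φ 1_{B(c,R+D)})(c)`, `B = B(a, R)`
(average the segment estimate over `z ∈ B`, swap the integrals, and bound each scaled-segment
average by `setLIntegral_ball_comp_homothety_le`). [folklore] -/
theorem enorm_average_sub_le [CompleteSpace F] {g : E → F} (hg : ContDiff ℝ 1 g)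
    {φ : E → ℝ≥0∞} (hφm : Measurable φ) (hφ : ∀ w, ‖fderiv ℝ g w‖ₑ ≤ φ w) (a c : E) {R : ℝ}
    (hR : 0 < R) :
    ‖(μ (ball a R)).toReal⁻¹ • (∫ z in ball a R, g z ∂μ) - g c‖ₑ ≤
      ENNReal.ofReal ((R + dist a c) * ((R + dist a c) / R) ^ finrank ℝ E) *
        maximalFunction μ ((ball c (R + dist a c)).indicator φ) c := by
  set n := finrank ℝ E with hn
  set D := dist a c with hD
  set B : Set E := ball a R with hB
  set Mc := maximalFunction μ ((ball c (R + D)).indicator φ) c with hMc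
  have hD0 : 0 ≤ D := dist_nonneg
  have hB0 : μ B ≠ 0 := (measure_ball_pos μ a hR).ne'
  have hBt : μ B ≠ ∞ := measure_ball_lt_top.ne
  have hgc : Continuous g := hg.continuous
  have hgi : IntegrableOn g B μ :=
    ((hgc.continuousOn).integrableOn_compact (isCompact_closedBall a R)).mono_set ball_subset_closedBall
  -- Step 1: the average minus `g c` is the average of `g z - g c`
  have e1 : (μ B).toReal⁻¹ • (∫ z in B, g z ∂μ) - g c = (μ B).toReal⁻¹ • ∫ z in B, (g z - g c) ∂μ := by
    rw [integral_sub hgi (integrableOn_const hBt), setIntegral_const, smul_sub, smul_smul,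
      measureReal_def, inv_mul_cancel₀ (ENNReal.toReal_ne_zero.2 ⟨hB0, hBt⟩), one_smul]
  -- Step 2: pointwise segment bound for `z ∈ B`: `‖z - c‖ ≤ R + D`
  have hseg : ∀ z ∈ B, ‖g z - g c‖ₑ ≤ ENNReal.ofReal (R + D) * (∫⁻ τ in Icc (0 : ℝ) 1, φ (c + τ • (z - c))) :=
    fun z hz => enorm_sub_le_lintegral_segment hg hφ (by
      calc ‖z - c‖ = dist z c := (dist_eq_norm z c).symm
        _ ≤ dist z a + dist a c := dist_triangle _ _ _
        _ ≤ R + D := add_le_add (le_of_lt (mem_ball.1 hz)) le_rfl)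
  -- Step 3: Tonelli and the scaled-segment bound
  have hmeas : Measurable (fun p : E × ℝ => φ (c + p.2 • (p.1 - c))) :=
    hφm.comp (measurable_const.add (measurable_snd.smul (measurable_fst.sub measurable_const)))
  have hswap : ∫⁻ z in B, (∫⁻ τ in Icc (0 : ℝ) 1, φ (c + τ • (z - c))) ∂μ =
      ∫⁻ τ in Icc (0 : ℝ) 1, (∫⁻ z in B, φ (c + τ • (z - c)) ∂μ) :=
    lintegral_lintegral_swap hmeas.aemeasurable
  have hinner : ∀ τ ∈ Ioc (0 : ℝ) 1, ∫⁻ z in B, φ (c + τ • (z - c)) ∂μ ≤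
      ENNReal.ofReal (((R + D) / R) ^ n) * μ B * Mc := fun τ hτ =>
    setLIntegral_ball_comp_homothety_le μ φ a c hR hτ.1 hτ.2
  have hIcc : ∫⁻ τ in Icc (0 : ℝ) 1, (∫⁻ z in B, φ (c + τ • (z - c)) ∂μ) =
      ∫⁻ τ in Ioc (0 : ℝ) 1, (∫⁻ z in B, φ (c + τ • (z - c)) ∂μ) :=
    setLIntegral_congr Ioc_ae_eq_Icc.symm
  have hτint : ∫⁻ τ in Icc (0 : ℝ) 1, (∫⁻ z in B, φ (c + τ • (z - c)) ∂μ) ≤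
      ENNReal.ofReal (((R + D) / R) ^ n) * μ B * Mc := by
    rw [hIcc]
    calc ∫⁻ τ in Ioc (0 : ℝ) 1, (∫⁻ z in B, φ (c + τ • (z - c)) ∂μ)
        ≤ ∫⁻ _ in Ioc (0 : ℝ) 1, ENNReal.ofReal (((R + D) / R) ^ n) * μ B * Mc :=
          setLIntegral_mono measurable_const hinner
      _ = ENNReal.ofReal (((R + D) / R) ^ n) * μ B * Mc := by
          rw [setLIntegral_const, Real.volume_Ioc, sub_zero, ENNReal.ofReal_one, mul_one]
  -- Step 4: assemble
  have hinv : ENNReal.ofReal ((μ B).toReal⁻¹) = (μ B)⁻¹ := by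
    rw [ENNReal.ofReal_inv_of_pos (ENNReal.toReal_pos hB0 hBt), ENNReal.ofReal_toReal hBt]
  calc ‖(μ B).toReal⁻¹ • (∫ z in B, g z ∂μ) - g c‖ₑ
      = (μ B)⁻¹ * ‖∫ z in B, (g z - g c) ∂μ‖ₑ := by
        rw [e1, enorm_smul, Real.enorm_eq_ofReal (inv_nonneg.2 ENNReal.toReal_nonneg), hinv]
    _ ≤ (μ B)⁻¹ * ∫⁻ z in B, ‖g z - g c‖ₑ ∂μ :=
        mul_le_mul' le_rfl (enorm_integral_le_lintegral_enorm _)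
    _ ≤ (μ B)⁻¹ * ∫⁻ z in B, (ENNReal.ofReal (R + D) * ∫⁻ τ in Icc (0 : ℝ) 1, φ (c + τ • (z - c))) ∂μ :=
        mul_le_mul' le_rfl (setLIntegral_mono' measurableSet_ball hseg)
    _ = (μ B)⁻¹ * (ENNReal.ofReal (R + D) * ∫⁻ τ in Icc (0 : ℝ) 1, (∫⁻ z in B, φ (c + τ • (z - c)) ∂μ)) := by
        rw [lintegral_const_mul' _ _ ENNReal.ofReal_ne_top, hswap]
    _ ≤ (μ B)⁻¹ * (ENNReal.ofReal (R + D) * (ENNReal.ofReal (((R + D) / R) ^ n) * μ B * Mc)) :=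
        mul_le_mul' le_rfl (mul_le_mul' le_rfl hτint)
    _ = ((μ B)⁻¹ * μ B) * (ENNReal.ofReal (R + D) * ENNReal.ofReal (((R + D) / R) ^ n)) * Mc := by ring
    _ = ENNReal.ofReal ((R + D) * ((R + D) / R) ^ n) * Mc := by
        rw [ENNReal.inv_mul_cancel hB0 hBt, one_mul,
          ENNReal.ofReal_mul (by linarith : (0 : ℝ) ≤ R + D)]

/-! ## The two-point inequality -/

/-- The dimensional constant `Cₙ = 3 (3/2)ⁿ` of the two-point inequality. [folklore] -/
def twoPointConst (n : ℕ) : ℝ := 3 * (3 / 2) ^ n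

/-- `0 ≤ Cₙ`. [folklore] -/
theorem twoPointConst_nonneg (n : ℕ) : 0 ≤ twoPointConst n := by
  unfold twoPointConst; positivity

/-- `2 ≤ Cₙ` and `3 (3/2)ⁿ ≤ Cₙ` bookkeeping: `2 ≤ Cₙ`. [folklore] -/
theorem two_le_twoPointConst (n : ℕ) : 2 ≤ twoPointConst n := by
  unfold twoPointConst
  have : (1 : ℝ) ≤ (3 / 2) ^ n := one_le_pow₀ (by norm_num)
  linarith

/-- **The two-point maximal inequality (Hedberg–Hajłasz) for `C¹` maps.** For `g ∈ C¹(E; F)`,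
a measurable size `φ ≥ ‖Dg‖ₑ` and all `a, b ∈ E`:
`‖g a - g b‖ₑ ≤ Cₙ · dist a b · (M(φ 1_{B(a,3|a-b|)})(a) + M(φ 1_{B(b,3|a-b|)})(b))`,
`Cₙ = 3(3/2)ⁿ` (Hajłasz 1996, (4) with Thm. 1, for smooth functions; compare both values with
the average over `B(a, 2|a-b|)`). [folklore] -/
theorem enorm_sub_le_mul_maximalFunction_add [CompleteSpace F] {g : E → F} (hg : ContDiff ℝ 1 g)
    {φ : E → ℝ≥0∞} (hφm : Measurable φ) (hφ : ∀ w, ‖fderiv ℝ g w‖ₑ ≤ φ w) (a b : E) :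
    ‖g a - g b‖ₑ ≤ ENNReal.ofReal (twoPointConst (finrank ℝ E) * dist a b) *
      (maximalFunction μ ((ball a (3 * dist a b)).indicator φ) a +
        maximalFunction μ ((ball b (3 * dist a b)).indicator φ) b) := by
  set n := finrank ℝ E with hn
  by_cases hab : a = b
  · subst hab
    simp
  set r := dist a b with hr
  have hr0 : 0 < r := dist_pos.2 hab
  have h2r : 0 < 2 * r := by linarith
  set A : F := (μ (ball a (2 * r))).toReal⁻¹ • ∫ z in ball a (2 * r), g z ∂μ with hA
  set Ma := maximalFunction μ ((ball a (3 * r)).indicator φ) a with hMa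
  set Mb := maximalFunction μ ((ball b (3 * r)).indicator φ) b with hMb
  -- the two potential estimates
  have ha : ‖A - g a‖ₑ ≤ ENNReal.ofReal (2 * r) * Ma := by
    have h := enorm_average_sub_le μ hg hφm hφ a a h2r
    rw [dist_self, add_zero, div_self h2r.ne', one_pow, mul_one] at h
    refine h.trans (mul_le_mul' le_rfl (maximalFunction_mono μ (fun y => ?_) a))
    exact indicator_le_indicator_of_subset (ball_subset_ball (by linarith)) (fun _ => bot_le) y
  have hb : ‖A - g b‖ₑ ≤ ENNReal.ofReal (3 * r * (3 / 2) ^ n) * Mb := by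
    have h := enorm_average_sub_le μ hg hφm hφ a b h2r
    have e1 : 2 * r + dist a b = 3 * r := by rw [← hr]; ring
    have e2 : (2 * r + dist a b) / (2 * r) = 3 / 2 := by
      rw [e1]; field_simp
    rw [e2, e1] at h
    exact h
  -- triangle inequality and constants
  have hC1 : ENNReal.ofReal (2 * r) ≤ ENNReal.ofReal (twoPointConst n * r) :=
    ENNReal.ofReal_le_ofReal (by nlinarith [two_le_twoPointConst n])
  have hC2 : ENNReal.ofReal (3 * r * (3 / 2) ^ n) ≤ ENNReal.ofReal (twoPointConst n * r) :=
    ENNReal.ofReal_le_ofReal (le_of_eq (by unfold twoPointConst; ring))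
  calc ‖g a - g b‖ₑ = edist (g a) (g b) := (edist_eq_enorm_sub _ _).symm
    _ ≤ edist (g a) A + edist A (g b) := edist_triangle _ _ _
    _ = ‖A - g a‖ₑ + ‖A - g b‖ₑ := by rw [edist_comm, edist_eq_enorm_sub, edist_eq_enorm_sub]
    _ ≤ ENNReal.ofReal (2 * r) * Ma + ENNReal.ofReal (3 * r * (3 / 2) ^ n) * Mb := add_le_add ha hb
    _ ≤ ENNReal.ofReal (twoPointConst n * r) * Ma + ENNReal.ofReal (twoPointConst n * r) * Mb :=
        add_le_add (mul_le_mul' hC1 le_rfl) (mul_le_mul' hC2 le_rfl)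
    _ = ENNReal.ofReal (twoPointConst n * r) * (Ma + Mb) := by rw [mul_add]

end Literature.Analysis.SingularIntegrals
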